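import Literature.IUT.HodgeTheaters.GoodLocalFrobenioidOfKitBases
import Literature.AlgebraicGeometry.Frobenioids.PadicFrobenioidDZeroSlim
import HarnessLib

/-!
# [IUTchI] Example 3.3 (iii) (b)(c) over the REAL coset bases: the slimness hypothesis in GROUP form, and
# clause (b) UNCONDITIONAL at the genuine `p`-adic instance `K_v = ℚ_p`, `Ω = ℚ̄_p`

S. Mochizuki, *Inter-universal Teichmüller theory I*, kurims manuscript (May 2020), Example 3.3 (iii) p. 79:
"(b) the category `𝒟⊢_v` (respectively, `𝒟^Θ_v`) may be reconstructed category-theoretically from `𝒞⊢_v`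
(respectively, `𝒞^Θ_v`) [cf. [FrdI], Theorem 3.4, (v); [FrdII], Theorem 1.2, (i); [FrdII], Example 1.3, (i);
[AbsAnab], Theorem 1.1.1, (ii)]; (c) the category `𝒟_v` may be reconstructed category-theoretically from `ℱ̲_v`
[cf. [FrdI], Theorem 3.4, (v); [FrdII], Theorem 1.2, (i); [FrdII], Example 1.3, (i); [AbsAnab], Lemma 1.3.1]"
[claim: Mochizuki2012, status: disputed] (D-0012 claim key, series status DISPUTED — this file is a PROOF-ONLY
composition of landed theorems of the cell; nothing of the series is asserted and no side is taken on
[IUTchIII] Cor. 3.12).  DAG node `IUTchI:Ex3.3(iii)`; rows E33iii/b, E33iii/c of `plan/L5/SUBDAG-IUTchI-Ex33-Ex34.md`.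

WHAT IS COMPOSED (no new definition, no new hypothesis):
* abc-iut-w4-d047's `GoodLocalFrobenioid.basesFromC_ofGalois` / `dFromF_ofGalois`
  (`GoodLocalFrobenioidOfKitBases.lean`): at abc-iut-L5-t2's REAL instance `ofGalois` ([IUTchI] Ex. 3.3 (i)–(ii)
  over the small coset models `CosetCat Π_v ⊇ CosetCat G_v`), clauses (b)/(c) hold as soon as the coset base is a
  SLIM CATEGORY ([FrdI] §0 p. 14) — FSM-type being discharged by `CosetCat.isOfFSMType`;
* abc-iut-L1-t4's `PadicFrd.isSlim_cosetCat_of_isSlimGroup` (`PadicFrobenioidDZeroSlim.lean`, on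
  `CosetCat.isSlim_of_isSlimGroup` of `CosetCategoriesSlim.lean`): for a PROFINITE group, group-slimness
  ([FrdI] §0 p. 13: centralisers of open subgroups trivial) implies slimness of the coset category — the printed
  "[AbsAnab], Theorem 1.1.1, (ii)" / "Lemma 1.3.1" are statements about GROUPS, so this is the form print cites;
* abc-iut-L1-t4's `PadicFrd.isSlim_cosetCat_galQp` (slimness of `G_{ℚ_p}`, abc-iut-L4's
  `IsSubpadicFor.isSlimGroup_absoluteGaloisGroup`): at `K_v = ℚ_p`, `Ω = ℚ̄_p` the hypothesis of (b) is a THEOREM.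

Results: `basesFromC_ofGalois_of_isSlimGroup`, `dFromF_ofGalois_of_isSlimGroup` (hypotheses in group form),
`basesFromC_ofGalois_ofPadic` ((b) with NO slimness binder at abc-iut-L5-t2's inhabitant `GaloisValDatum.ofPadic`),
`basesFromC_and_dFromF_ofPadic_self` ((b) ∧ (c) with no hypothesis at all at the explicit instance
`Π_v := G_{ℚ_p}`, `aug := id` — non-vacuity of both clauses at a real Galois base; print's `Π_v` is the arithmetic
fundamental group of `X̲→_v`, whose slimness is [AbsAnab] Lem. 1.3.1, consumed BY NAME in
`dFromF_ofGalois_of_isSlimGroup`).  typed ≠ proved elsewhere; no side taken on [IUTchIII] Cor. 3.12.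
-/

namespace Literature.IUT.HodgeTheaters

open CategoryTheory Literature.AnabelianGeometry.SemiGraphs Literature.AlgebraicGeometry.Frobenioids
open Literature.AlgebraicGeometry.Frobenioids.PadicFrd

universe u

namespace GoodLocalFrobenioid

section GroupForm

variable {p : ℕ} [Fact p.Prime] (d : GaloisValDatum.{u} p) {P : Type u} [Group P] [TopologicalSpace P]
  (aug : P →* d.Gal) (hc : Continuous aug) (hs : Function.Surjective aug) (ho : IsOpenMap aug)
  (Kv : Type) [Field Kv] [ValuativeRel Kv] (hp : ((p : Kv)) ∈ PadicFrd.intNonzero Kv)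

/-- **[IUTchI] Ex. 3.3 (iii) (b) over the REAL base `𝒟⊢_v = 𝓑(G_v)⁰`, hypothesis in the PRINTED (group) form**:
if the profinite group `G_v = Gal(Ω/K_v)` is slim ("[AbsAnab], Theorem 1.1.1, (ii)": centralisers of open
subgroups are trivial), then `𝒟⊢_v` (resp. `𝒟^Θ_v`) is reconstructible from `𝒞⊢_v` (resp. `𝒞^Θ_v`) at
abc-iut-L5-t2's instance `ofGalois`.  Composition of `basesFromC_ofGalois` (slim coset CATEGORY suffices) with
`PadicFrd.isSlim_cosetCat_of_isSlimGroup` (slim profinite GROUP ⇒ slim coset category).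
([IUTchI] Ex 3.3 (iii) p.79) [claim: Mochizuki2012, status: disputed] -/
theorem basesFromC_ofGalois_of_isSlimGroup [IsTopologicalGroup d.Gal] [CompactSpace d.Gal]
    [TotallyDisconnectedSpace d.Gal] (hZ : IsSlimGroup d.Gal) :
    (ofGalois d aug hc hs ho Kv hp).BasesFromC :=
  basesFromC_ofGalois d aug hc hs ho Kv hp (PadicFrd.isSlim_cosetCat_of_isSlimGroup hZ)

/-- **[IUTchI] Ex. 3.3 (iii) (c) over the REAL base `𝒟_v = 𝓑(Π_v)⁰`, hypothesis in the PRINTED (group) form**: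
if the profinite group `Π_v` is slim ("[AbsAnab], Lemma 1.3.1": `Π_v` slim), then `𝒟_v` is reconstructible from
`ℱ̲_v = 𝒞_v` at `ofGalois`.  Composition of `dFromF_ofGalois` with `PadicFrd.isSlim_cosetCat_of_isSlimGroup`.
([IUTchI] Ex 3.3 (iii) p.79) [claim: Mochizuki2012, status: disputed] -/
theorem dFromF_ofGalois_of_isSlimGroup [IsTopologicalGroup P] [CompactSpace P] [TotallyDisconnectedSpace P]
    (hZ : IsSlimGroup P) :
    (ofGalois d aug hc hs ho Kv hp).DFromF :=
  dFromF_ofGalois d aug hc hs ho Kv hp (PadicFrd.isSlim_cosetCat_of_isSlimGroup hZ)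

end GroupForm

section OfPadic

variable (p : ℕ) [Fact p.Prime] {P : Type} [Group P] [TopologicalSpace P]
  (aug : P →* (GaloisValDatum.ofPadic p).Gal) (hc : Continuous aug) (hs : Function.Surjective aug)
  (ho : IsOpenMap aug) (Kv : Type) [Field Kv] [ValuativeRel Kv] (hp : ((p : Kv)) ∈ PadicFrd.intNonzero Kv)

/-- **[IUTchI] Ex. 3.3 (iii) (b) UNCONDITIONAL at the genuine `p`-adic instance** `K_v = ℚ_p`, `Ω = ℚ̄_p`
(abc-iut-L5-t2's inhabitant `GaloisValDatum.ofPadic`): `𝒟⊢_v = 𝓑(G_{ℚ_p})⁰` (resp. `𝒟^Θ_v`) is reconstructible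
from `𝒞⊢_v` (resp. `𝒞^Θ_v`) for EVERY `Π_v ↠ G_{ℚ_p}` — no slimness binder: `G_{ℚ_p}` is slim by the tree's
theorem (`PadicFrd.isSlim_cosetCat_galQp`, from abc-iut-L4's `IsSubpadicFor.isSlimGroup_absoluteGaloisGroup`).
([IUTchI] Ex 3.3 (iii) p.79) [claim: Mochizuki2012, status: disputed] -/
theorem basesFromC_ofGalois_ofPadic : (ofGalois (GaloisValDatum.ofPadic p) aug hc hs ho Kv hp).BasesFromC :=
  basesFromC_ofGalois (GaloisValDatum.ofPadic p) aug hc hs ho Kv hp (PadicFrd.isSlim_cosetCat_galQp p)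

/-- **Clauses (b) and (c) with NO hypothesis at all** at the explicit instance `K_v = ℚ_p`, `Ω = ℚ̄_p`,
`Π_v := G_{ℚ_p}`, `aug := id` (so `𝒟_v = 𝒟⊢_v = 𝓑(G_{ℚ_p})⁰`): both typed clauses are satisfied at a REAL Galois
base — a non-vacuity certificate for abc-iut-L5-t2's `BasesFromC` / `DFromF` at genuine [FrdII] objects.  (Print's
`Π_v` is the arithmetic fundamental group of `X̲→_v`; for it, use `dFromF_ofGalois_of_isSlimGroup` with
[AbsAnab] Lem. 1.3.1 BY NAME.) ([IUTchI] Ex 3.3 (iii) p.79) [claim: Mochizuki2012, status: disputed] -/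
theorem basesFromC_and_dFromF_ofPadic_self :
    (ofGalois (GaloisValDatum.ofPadic p) (MonoidHom.id _) continuous_id Function.surjective_id IsOpenMap.id
        Kv hp).BasesFromC ∧
      (ofGalois (GaloisValDatum.ofPadic p) (MonoidHom.id _) continuous_id Function.surjective_id IsOpenMap.id
        Kv hp).DFromF :=
  ⟨basesFromC_ofGalois (GaloisValDatum.ofPadic p) _ _ _ _ Kv hp (PadicFrd.isSlim_cosetCat_galQp p),
    dFromF_ofGalois (GaloisValDatum.ofPadic p) _ _ _ _ Kv hp (PadicFrd.isSlim_cosetCat_galQp p)⟩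

end OfPadic

end GoodLocalFrobenioid

end Literature.IUT.HodgeTheaters
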